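import Mathlib.Analysis.SpecialFunctions.Pow.Real
import Mathlib.Analysis.SpecialFunctions.Pow.Asymptotics
import Literature.Computability.FineGrained.Conjectures
import Literature.Computability.FineGrained.ConjecturesThreeSUMDetProofs
import Literature.Computability.FineGrained.SubcubicEquivalencesAPSP
import Literature.Computability.Cryptography.WordRAMReads
import Literature.Computability.Cryptography.WordRAMProofs
import HarnessLib

/-!
# `k`-SUM and 3SUM have no sublinear-time randomised algorithms (the cases `k = 1, 2` of the `k`-SUM conjecture)

The unconditional, folklore part of the `k`-SUM / 3SUM hypotheses of
`Literature.Computability.FineGrained.Conjectures`, by the unread-input-cell adversary argument in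
its randomised form, over the concrete word RAM of `Literature.Computability.Cryptography.WordRAM`:

* `WordRAM.exists_unread_successProb_lt` (**randomised unread-cell adversary**): if an oracle-free
  program answers correctly on input `x` (accepted outputs of length `≤ 2`) with probability
  `≥ 2/3` within `t` steps and `15 t + 3 ≤ |x|`, then some input word `p ≥ 2` is read by so few of
  the successful runs (double counting over coin vectors: each run reads `≤ 5t` cells,
  `WordRAM.OutputsWithin.exists_reads`) that on *every* input `x₂` differing from `x` only in word
  `p`, every set of outputs disjoint from the accepted ones is hit with probability `< 2/3` — the
  runs that succeed on `x` without reading cell `p + 1` produce the same, now wrong, output on `x₂`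
  (`WordRAM.outputsWithin_unique`);
* `not_randInTimeO_rpow_of_planted`: hence a decision problem on integer lists (zoo format
  `FGProblem.ofPred encodeIntList List.length pr` restricted to a promise set) whose answer flips
  when one entry `v` is planted into the all-ones list has no randomised `O(n^a)`-time algorithm for
  any `a < 1`;
* `kSUM_not_randInTimeO_rpow_of_lt_one` (`k ≥ 1`, planting `1 - k`),
  `threeSUM_not_randInTimeO_rpow_of_lt_one` (planting `-2`), and their deterministic forms;
* consequences for the vendored conjectures: **`kSUMConjecture_one : KSUMConjecture 1`** and
  **`kSUMConjecture_two : KSUMConjecture 2`** (the exponent `⌈k/2⌉ = 1` makes these the statements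
  "`1`-SUM / `2`-SUM have no sublinear randomised algorithm", noted as "true by the standard
  unread-position adversary argument, not formalised here" in the docstring of `KSUMConjecture`;
  now formalised), `kSUMConjecture_of_lt` (for every `k ≥ 1` the `k`-SUM conjecture holds at all
  `ε > ⌈k/2⌉ - 1`), `threeSUMConjecture_of_one_lt` and `threeSUMConjecture_iff_forall_le_one`
  (the randomised 3SUM conjecture, VVW IPEC 2015 §2.1 Conj. 1, is equivalent to its restriction to
  `0 < ε ≤ 1`, exactly as its deterministic form, `threeSUMConjectureDet_iff_forall_le_one`).

For `k ≥ 3` and `0 < ε ≤ ⌈k/2⌉ - 1` the statements remain the open `k`-SUM / 3SUM conjectures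
(Abboud–Lewi, ICALP 2013, §1 Conj. 1; VVW IPEC 2015, §2.1 Conj. 1); nothing here bears on them.

## References

* V. Vassilevska Williams, IPEC 2015 (LIPIcs 43), §2.1, Conjecture 1 (3SUM); A. Abboud, K. Lewi,
  ICALP 2013, §1, Conjecture 1 (`k`-SUM, stated for `k ≥ 2`).
* Input-reading (`Ω(n)`) lower bounds for randomised algorithms: folklore.
-/

namespace Literature.Computability.Cryptography.WordRAM

open Finset

/-- **Randomised unread-cell adversary.** Let `P` be oracle-free and suppose that on input `x`,
with accepted outputs `S` all of length `≤ 2`, `P` outputs into `S` within `t` steps with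
probability `≥ 2/3`, where `15 t + 3 ≤ |x|`. Then there is an input position `p`, `2 ≤ p < |x|`,
such that for every input `x₂` of the same length differing from `x` at most in word `p` and every
set `S₂` of outputs disjoint from `S`, `P` outputs into `S₂` on `x₂` within `t` steps with
probability `< 2/3`. (Each successful run reads `≤ 5t` cells, so by double counting some cell
`p + 1 ∈ {3, …, |x|}` is read by at most a `5t / (|x| - 2) < 1/3` fraction of all coin vectors among
the successful ones; the other successful runs do not notice the change and output into `S` on
`x₂`, by uniqueness of the output not into `S₂`.) [folklore] -/
theorem exists_unread_successProb_lt {P : Program} (hP : P.IsOracleFree) (w : ℕ) (x : List ℕ)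
    (S : Set (List ℕ)) (hS : ∀ out ∈ S, out.length ≤ 2) (t : ℕ)
    (h23 : (2 / 3 : ℝ) ≤ successProb P w noOracle x S t) (ht : 15 * t + 3 ≤ x.length) :
    ∃ p : ℕ, 2 ≤ p ∧ p < x.length ∧ ∀ x₂ : List ℕ, x₂.length = x.length →
      (∀ i, x₂[i]? ≠ x[i]? → i = p) → ∀ S₂ : Set (List ℕ), Disjoint S S₂ →
        successProb P w noOracle x₂ S₂ t < 2 / 3 := by
  classical
  unfold successProb at h23 ⊢
  -- the number of coin vectors
  set N : ℕ := (2 ^ w) ^ t with hN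
  have hNpos : 0 < N := by positivity
  have hNcard : Fintype.card (Fin t → Fin (2 ^ w)) = N := by
    rw [Fintype.card_fun, Fintype.card_fin, Fintype.card_fin]
  have hNreal : ((2 : ℝ) ^ w) ^ t = (N : ℝ) := by push_cast [hN]; ring
  rw [hNreal] at h23
  -- the successful coin vectors on `x`
  set SA : Finset (Fin t → Fin (2 ^ w)) :=
    univ.filter fun ρ => ∃ out ∈ S, OutputsWithin P w noOracle (coinStream ρ) x out t with hSA
  have hSA_card : 2 * N ≤ 3 * SA.card := by
    rw [le_div_iff₀ (by exact_mod_cast hNpos)] at h23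
    have h : (2 * N : ℝ) ≤ 3 * SA.card := by linarith
    exact_mod_cast h
  have hSA_le : SA.card ≤ N := hNcard ▸ card_le_univ _
  -- the cells read by each successful run, and its output
  have key : ∀ ρ : Fin t → Fin (2 ^ w),
      (∃ out ∈ S, OutputsWithin P w noOracle (coinStream ρ) x out t) →
      ∃ R : Finset ℕ, R.card ≤ 5 * t ∧ ∃ out ∈ S, ∀ x₂ : List ℕ, x₂.length = x.length →
        (∀ i, x₂[i]? ≠ x[i]? → i + 1 ∉ R ∧ out.length ≤ i) →
        OutputsWithin P w noOracle (coinStream ρ) x₂ out t := by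
    rintro ρ ⟨out, hout, hrun⟩
    obtain ⟨R, hR, hreads⟩ := hrun.exists_reads hP
    exact ⟨R, hR, out, hout, hreads⟩
  choose! reads hreads_card out hout hreads_out using key
  -- double counting: some cell `u ∈ {3, …, n}` is read by few successful runs
  set n := x.length with hn
  set I : Finset ℕ := Icc 3 n with hI
  have hIcard : I.card = n - 2 := by rw [hI, Nat.card_Icc]; omega
  have hIne : I.Nonempty := ⟨3, by rw [hI, mem_Icc]; omega⟩
  set cnt : ℕ → ℕ := fun u => (SA.filter fun ρ => u ∈ reads ρ).card with hcnt
  have hsum : ∑ u ∈ I, cnt u ≤ 5 * t * SA.card := by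
    calc ∑ u ∈ I, cnt u = ∑ u ∈ I, ∑ ρ ∈ SA, (if u ∈ reads ρ then 1 else 0) :=
          sum_congr rfl fun u _ => card_filter _ _
      _ = ∑ ρ ∈ SA, ∑ u ∈ I, (if u ∈ reads ρ then 1 else 0) := sum_comm
      _ = ∑ ρ ∈ SA, (I.filter fun u => u ∈ reads ρ).card :=
          sum_congr rfl fun ρ _ => (card_filter _ _).symm
      _ ≤ ∑ ρ ∈ SA, 5 * t := by
          refine sum_le_sum fun ρ hρ => ?_
          have hgρ := (mem_filter.1 hρ).2
          calc (I.filter fun u => u ∈ reads ρ).card ≤ (reads ρ).card :=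
                card_le_card fun u hu => (mem_filter.1 hu).2
            _ ≤ 5 * t := hreads_card ρ hgρ
      _ = 5 * t * SA.card := by rw [sum_const, smul_eq_mul]; ring
  obtain ⟨u, huI, humin⟩ := exists_min_image I cnt hIne
  have hu_cnt : (n - 2) * cnt u ≤ 5 * t * SA.card := by
    calc (n - 2) * cnt u = ∑ _v ∈ I, cnt u := by rw [sum_const, smul_eq_mul, hIcard]
      _ ≤ ∑ v ∈ I, cnt v := sum_le_sum fun v hv => humin v hv
      _ ≤ 5 * t * SA.card := hsum
  have hcnt3 : 3 * cnt u < N := by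
    have h1 : (n - 2) * (3 * cnt u) ≤ 15 * t * N :=
      calc (n - 2) * (3 * cnt u) = 3 * ((n - 2) * cnt u) := by ring
        _ ≤ 3 * (5 * t * SA.card) := Nat.mul_le_mul_left 3 hu_cnt
        _ = 15 * t * SA.card := by ring
        _ ≤ 15 * t * N := Nat.mul_le_mul_left _ hSA_le
    have h2 : 15 * t * N < (n - 2) * N := Nat.mul_lt_mul_of_pos_right (by omega) hNpos
    exact Nat.lt_of_mul_lt_mul_left (h1.trans_lt h2)
  rw [hI, mem_Icc] at huI
  refine ⟨u - 1, by omega, by omega, fun x₂ hlen hdiff S₂ hdisj => ?_⟩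
  -- the successful runs on `x` not reading cell `u` fail on `x₂`
  set T : Finset (Fin t → Fin (2 ^ w)) := SA.filter fun ρ => u ∉ reads ρ with hT
  have hT_card : T.card + cnt u = SA.card := by
    rw [hT, hcnt, add_comm]
    exact card_filter_add_card_filter_not _
  set SB : Finset (Fin t → Fin (2 ^ w)) :=
    univ.filter fun ρ => ∃ out ∈ S₂, OutputsWithin P w noOracle (coinStream ρ) x₂ out t with hSB
  have hTfail : ∀ ρ ∈ T, ρ ∉ SB := by
    intro ρ hρ hρB
    obtain ⟨hρA, hρu⟩ := mem_filter.1 hρ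
    have hgρ := (mem_filter.1 hρA).2
    obtain ⟨out₂, hout₂, hrun₂⟩ := (mem_filter.1 hρB).2
    have hrun₁ : OutputsWithin P w noOracle (coinStream ρ) x₂ (out ρ) t := by
      refine hreads_out ρ hgρ x₂ hlen fun i hi => ?_
      have hip := hdiff i hi
      subst hip
      refine ⟨?_, (hS _ (hout ρ hgρ)).trans (by omega)⟩
      rwa [Nat.sub_add_cancel (by omega)]
    have heq := outputsWithin_unique_holds hrun₁ hrun₂
    exact Set.disjoint_left.1 hdisj (hout ρ hgρ) (heq ▸ hout₂)
  have hSBT : SB.card + T.card ≤ N := by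
    rw [← hNcard, ← (card_union_eq_card_add_card.2 (disjoint_left.2 fun ρ hρB hρT =>
      hTfail ρ hρT hρB))]
    exact card_le_univ _
  -- count: `3 |SB| ≤ 3N - 3|T| = 3N - 3|SA| + 3 cnt u ≤ N + 3 cnt u < 2N`
  rw [div_lt_iff₀ (by exact_mod_cast hNpos)]
  have h3 : 3 * SB.card < 2 * N := by omega
  have h3' : (3 * SB.card : ℝ) < 2 * N := by exact_mod_cast h3
  linarith

end Literature.Computability.Cryptography.WordRAM

namespace Literature.Computability.FineGrained

open Filter Cryptography Cryptography.WordRAM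

/-! ## The budget is eventually sublinear (any constant factor) -/

/-- For `a < 1` the budget `⌊C n^a + C⌋₊` eventually satisfies `K ⌊C n^a + C⌋₊ + 3 ≤ n`, beyond
any prescribed `m`. [folklore] -/
theorem exists_mul_floor_add_three_le (C : ℝ) {a : ℝ} (ha : a < 1) (K m : ℕ) :
    ∃ n : ℕ, m ≤ n ∧ K * ⌊C * (n : ℝ) ^ a + C⌋₊ + 3 ≤ n := by
  set C' := max C 0 with hC'
  have hC'0 : 0 ≤ C' := le_max_right _ _
  have hCC' : C ≤ C' := le_max_left _ _
  have hδ : 0 < 1 - a := by linarith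
  have h1 : ∀ᶠ n : ℕ in atTop, 2 * K * C' ≤ (n : ℝ) ^ (1 - a) :=
    ((tendsto_rpow_atTop hδ).comp tendsto_natCast_atTop_atTop).eventually_ge_atTop _
  have h2 : ∀ᶠ n : ℕ in atTop, 2 * K * C' + 6 ≤ (n : ℝ) :=
    tendsto_natCast_atTop_atTop.eventually_ge_atTop _
  have h3 : ∀ᶠ n : ℕ in atTop, max m 1 ≤ n := eventually_ge_atTop _
  obtain ⟨n, hn1, hn2, hn3⟩ := (h1.and (h2.and h3)).exists
  refine ⟨n, le_of_max_le_left hn3, ?_⟩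
  have hn0 : (0 : ℝ) < n := by exact_mod_cast (by omega : 0 < n)
  have hna : (0 : ℝ) ≤ (n : ℝ) ^ a := Real.rpow_nonneg hn0.le a
  have hK0 : (0 : ℝ) ≤ K := Nat.cast_nonneg K
  have hfloor : (⌊C * (n : ℝ) ^ a + C⌋₊ : ℝ) ≤ C' * (n : ℝ) ^ a + C' := by
    have hle : C * (n : ℝ) ^ a + C ≤ C' * (n : ℝ) ^ a + C' :=
      add_le_add (mul_le_mul_of_nonneg_right hCC' hna) hCC'
    rcases le_or_gt 0 (C * (n : ℝ) ^ a + C) with h0 | h0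
    · exact (Nat.floor_le h0).trans hle
    · rw [Nat.floor_of_nonpos h0.le, Nat.cast_zero]
      positivity
  have hkey : 2 * K * C' * (n : ℝ) ^ a ≤ n := by
    calc 2 * K * C' * (n : ℝ) ^ a ≤ (n : ℝ) ^ (1 - a) * (n : ℝ) ^ a :=
          mul_le_mul_of_nonneg_right hn1 hna
      _ = n := by rw [← Real.rpow_add hn0, sub_add_cancel, Real.rpow_one]
  have h : ((K * ⌊C * (n : ℝ) ^ a + C⌋₊ + 3 : ℕ) : ℝ) ≤ n := by
    push_cast
    have hKf : (K : ℝ) * ⌊C * (n : ℝ) ^ a + C⌋₊ ≤ K * (C' * (n : ℝ) ^ a + C') :=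
      mul_le_mul_of_nonneg_left hfloor hK0
    nlinarith [hKf, hkey, hn2, hC'0, hna, hK0]
  exact_mod_cast h

/-! ## Planted instances: no sublinear randomised algorithm -/

/-- **Planted-entry adversary for decision problems on integer lists.** Let `pr` be a property of
integer lists and `S` a promise set (zoo format: `FGProblem.ofPred encodeIntList List.length pr`
restricted to `S`, size = length). Suppose that for all lengths `n ≥ m` the all-ones list is a
no-instance in `S`, that planting the entry `v` at any position `2 ≤ p < n` gives a yes-instance in
`S`, and that the code of `v` is at most `m` (so both instances are run with the same word size,
`inputWidth = Nat.size n`). Then the problem has no randomised `O(n^a)`-time word-RAM algorithm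
(success probability `≥ 2/3`) for any `a < 1`: by `WordRAM.exists_unread_successProb_lt` applied to
the all-ones instance, some planted instance is answered `[1]` with probability `< 2/3`.
[folklore] -/
theorem not_randInTimeO_rpow_of_planted {pr : List ℤ → Prop} {S : Set (List ℤ)} {v : ℤ} {m : ℕ}
    (hv : encodeInt v ≤ m)
    (hA : ∀ n, m ≤ n → List.replicate n (1 : ℤ) ∈ S ∧ ¬ pr (List.replicate n 1))
    (hB : ∀ n p, m ≤ n → 2 ≤ p → p < n →
      (List.replicate n (1 : ℤ)).set p v ∈ S ∧ pr ((List.replicate n 1).set p v))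
    {a : ℝ} (ha : a < 1) :
    ¬ ((FGProblem.ofPred encodeIntList List.length pr).restrict S).RandInTimeO
      fun n => (n : ℝ) ^ a := by
  set Q := (FGProblem.ofPred encodeIntList List.length pr).restrict S with hQ
  rintro ⟨C, M, k, hof, hM⟩
  obtain ⟨n, hmn, hbudget⟩ := exists_mul_floor_add_three_le C ha 15 (max m 3)
  have hm : m ≤ n := le_of_max_le_left hmn
  have hn3 : 3 ≤ n := le_of_max_le_right hmn
  -- the all-ones instance `A`
  obtain ⟨hAS, hApr⟩ := hA n hm
  let A : Q.Inst := ⟨List.replicate n 1, hAS⟩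
  have hencA : Q.encode A = List.replicate n 2 := by
    show (List.replicate n (1 : ℤ)).map encodeInt = _
    rw [List.map_replicate]
    rfl
  have hsizeA : Q.size A = n := by
    show (List.replicate n (1 : ℤ)).length = n
    exact List.length_replicate
  have hgoodA : Q.Good A = {[0]} := by
    show (FGProblem.ofPred encodeIntList List.length pr).Good (List.replicate n 1) = _
    exact FGProblem.ofPred_good_of_neg _ _ _ _ hApr
  have hwA : Q.width A = Nat.size n := by
    show inputWidth (Q.encode A) = _
    rw [hencA]
    refine inputWidth_eq_size_of_forall_le List.length_replicate (by omega) fun b hb => ?_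
    rw [List.eq_of_mem_replicate hb]
    omega
  have h23A : (2 / 3 : ℝ) ≤ successProb M (k * Q.width A) noOracle (Q.encode A) {[0]}
      ⌊C * (n : ℝ) ^ a + C⌋₊ := by
    simpa only [hgoodA, hsizeA] using hM A
  obtain ⟨p, hp2, hpn, hfail⟩ := exists_unread_successProb_lt hof (k * Q.width A) (Q.encode A)
    {[0]} (by simp) _ h23A (by rw [hencA, List.length_replicate]; exact hbudget)
  rw [hencA, List.length_replicate] at hpn
  -- the planted instance `B`
  obtain ⟨hBS, hBpr⟩ := hB n p hm hp2 hpn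
  let B : Q.Inst := ⟨(List.replicate n 1).set p v, hBS⟩
  have hencB : Q.encode B = (List.replicate n 2).set p (encodeInt v) := by
    show ((List.replicate n (1 : ℤ)).set p v).map encodeInt = _
    rw [List.map_set, List.map_replicate]
    rfl
  have hsizeB : Q.size B = n := by
    show ((List.replicate n (1 : ℤ)).set p v).length = n
    rw [List.length_set, List.length_replicate]
  have hgoodB : Q.Good B = {[1]} := by
    show (FGProblem.ofPred encodeIntList List.length pr).Good ((List.replicate n 1).set p v) = _
    exact FGProblem.ofPred_good_of_pos _ _ _ _ hBpr
  have hwB : Q.width B = Nat.size n := by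
    show inputWidth (Q.encode B) = _
    rw [hencB]
    refine inputWidth_eq_size_of_forall_le (by simp) (by omega) fun b hb => ?_
    rcases List.mem_or_eq_of_mem_set hb with hb | rfl
    · rw [List.eq_of_mem_replicate hb]
      omega
    · omega
  have h23B : (2 / 3 : ℝ) ≤ successProb M (k * Q.width A) noOracle (Q.encode B) {[1]}
      ⌊C * (n : ℝ) ^ a + C⌋₊ := by
    simpa only [hgoodB, hsizeB, hwB, ← hwA] using hM B
  have hlt := hfail (Q.encode B) (by rw [hencA, hencB]; simp) (fun i hi => by
    rw [hencA, hencB] at hi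
    by_contra hip
    exact hi (List.getElem?_set_ne (Ne.symm hip))) {[1]} (by simp)
  exact absurd h23B (not_le.2 hlt)

/-! ## `k`-SUM: the planted instances -/

/-- The all-ones list has no `k` entries at distinct positions summing to `0`, for `k ≥ 1`
(the sum is `k`). [folklore] -/
theorem not_hasKSum_replicate_one {k : ℕ} (hk : 1 ≤ k) (n : ℕ) :
    ¬ HasKSum k (List.replicate n (1 : ℤ)) := by
  rintro ⟨s, hs, hsum⟩
  simp only [List.get_eq_getElem, List.getElem_replicate, Finset.sum_const, hs,
    nsmul_eq_mul, mul_one] at hsum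
  omega

/-- Planting `1 - k` at position `p` of the all-ones list of length `n ≥ k` creates a `k`-SUM
solution (position `p` together with any `k - 1` other positions: `(1 - k) + (k - 1) = 0`).
[folklore] -/
theorem hasKSum_replicate_one_set {k n p : ℕ} (hk : 1 ≤ k) (hkn : k ≤ n) (hpn : p < n) :
    HasKSum k ((List.replicate n (1 : ℤ)).set p (1 - k)) := by
  set l := (List.replicate n (1 : ℤ)).set p (1 - k) with hl
  have hlen : l.length = n := by simp [hl]
  let P : Fin l.length := ⟨p, by omega⟩
  obtain ⟨T, hT, hTcard⟩ := Finset.exists_subset_card_eq (s := Finset.univ.erase P) (n := k - 1)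
    (by rw [Finset.card_erase_of_mem (Finset.mem_univ _), Finset.card_univ, Fintype.card_fin]; omega)
  have hPT : P ∉ T := fun h => Finset.notMem_erase P _ (hT h)
  refine ⟨insert P T, by rw [Finset.card_insert_of_notMem hPT, hTcard]; omega, ?_⟩
  rw [Finset.sum_insert hPT]
  have hP : l.get P = 1 - k := by
    simp only [List.get_eq_getElem, hl, P]
    exact List.getElem_set_self _
  have hrest : ∀ i ∈ T, l.get i = 1 := by
    intro i hi
    have hip : (i : ℕ) ≠ p := fun h => Finset.ne_of_mem_erase (hT hi) (Fin.ext h)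
    simp only [List.get_eq_getElem, hl]
    rw [List.getElem_set_ne (Ne.symm hip), List.getElem_replicate]
  rw [hP, Finset.sum_congr rfl hrest, Finset.sum_const, hTcard, nsmul_eq_mul, mul_one,
    Nat.cast_sub hk]
  push_cast
  ring

/-- The all-ones list of length `n ≥ 1` has entries in `{-nᵏ, …, nᵏ}`. [folklore] -/
theorem hasBoundedEntries_replicate_one_pow {n : ℕ} (hn : 1 ≤ n) (k : ℕ) :
    HasBoundedEntries (List.replicate n (1 : ℤ)) ((List.replicate n (1 : ℤ)).length ^ k) := by
  intro z hz
  rw [List.eq_of_mem_replicate hz, List.length_replicate, abs_one]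
  exact_mod_cast Nat.one_le_pow k n hn

/-- The planted list (`1 - k` at position `p`) of length `n ≥ k`, `n ≥ 1`, has entries in
`{-nᵏ, …, nᵏ}` (`|1 - k| = k - 1 ≤ n ≤ nᵏ`). [folklore] -/
theorem hasBoundedEntries_replicate_one_set_pow {k n : ℕ} (hk : 1 ≤ k) (hkn : k ≤ n) (p : ℕ) :
    HasBoundedEntries ((List.replicate n (1 : ℤ)).set p (1 - k))
      (((List.replicate n (1 : ℤ)).set p (1 - k)).length ^ k) := by
  intro z hz
  rw [List.length_set, List.length_replicate]
  have hn1 : 1 ≤ n := hk.trans hkn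
  have hnk : ((n ^ k : ℕ) : ℤ) ≥ n := by exact_mod_cast Nat.le_self_pow (by omega) n
  rcases List.mem_or_eq_of_mem_set hz with hz | rfl
  · rw [List.eq_of_mem_replicate hz, abs_one]
    omega
  · rw [abs_le]
    constructor <;> omega

/-- The code of the planted entry `1 - k` is at most `2k`. [folklore] -/
theorem encodeInt_one_sub_le (k : ℕ) (hk : 1 ≤ k) : encodeInt (1 - (k : ℤ)) ≤ 2 * k := by
  have h := encodeInt_le_two_mul_natAbs (1 - (k : ℤ))
  have h2 : (1 - (k : ℤ)).natAbs = k - 1 := by omega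
  rw [h2] at h
  omega

/-! ## `k`-SUM and 3SUM: no sublinear randomised (or deterministic) algorithm -/

/-- **`k`-SUM has no sublinear-time randomised algorithm** (`k ≥ 1`): for `a < 1` there is no
randomised word-RAM algorithm (success probability `≥ 2/3`) deciding `kSUM k` (`n` integers of
`{-nᵏ, …, nᵏ}`) in time `O(n^a)`. Planted-entry adversary with `v = 1 - k`. [folklore] -/
theorem kSUM_not_randInTimeO_rpow_of_lt_one {k : ℕ} (hk : 1 ≤ k) {a : ℝ} (ha : a < 1) :
    ¬ (kSUM k).RandInTimeO fun n => (n : ℝ) ^ a :=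
  not_randInTimeO_rpow_of_planted (pr := HasKSum k)
    (S := {l : List ℤ | HasBoundedEntries l (l.length ^ k)}) (v := 1 - (k : ℤ)) (m := 2 * k)
    (encodeInt_one_sub_le k hk)
    (fun n hn => ⟨hasBoundedEntries_replicate_one_pow (by omega) k, not_hasKSum_replicate_one hk n⟩)
    (fun n p hn _ hpn =>
      ⟨hasBoundedEntries_replicate_one_set_pow hk (by omega) p,
        hasKSum_replicate_one_set hk (by omega) hpn⟩)
    ha

/-- **3SUM has no sublinear-time randomised algorithm**: for `a < 1` there is no randomised
word-RAM algorithm (success probability `≥ 2/3`) deciding `threeSUM` in time `O(n^a)`.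
Planted-entry adversary with `v = -2` (instances of `…ConjecturesThreeSUMDetProofs`). [folklore] -/
theorem threeSUM_not_randInTimeO_rpow_of_lt_one {a : ℝ} (ha : a < 1) :
    ¬ threeSUM.RandInTimeO fun n => (n : ℝ) ^ a :=
  not_randInTimeO_rpow_of_planted (pr := HasThreeSum)
    (S := {l : List ℤ | HasBoundedEntries l (l.length ^ 3)}) (v := -2) (m := 3) (le_of_eq rfl)
    (fun n hn => ⟨hasBoundedEntries_replicate_one (by omega), not_hasThreeSum_replicate_one n⟩)
    (fun n p hn hp hpn =>
      ⟨hasBoundedEntries_replicate_one_set (by omega) p, hasThreeSum_replicate_one_set hp hpn⟩)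
    ha

/-- `k`-SUM (`k ≥ 1`) has no sublinear-time deterministic algorithm either (a deterministic
algorithm is a randomised one, `FGProblem.InTimeO.randInTimeO'`). [folklore] -/
theorem kSUM_not_inTimeO_rpow_of_lt_one {k : ℕ} (hk : 1 ≤ k) {a : ℝ} (ha : a < 1) :
    ¬ (kSUM k).InTimeO fun n => (n : ℝ) ^ a :=
  fun h => kSUM_not_randInTimeO_rpow_of_lt_one hk ha h.randInTimeO'

/-! ## Consequences for the vendored conjectures -/

/-- **The `k`-SUM conjecture holds in its sublinear regime**: for `k ≥ 1` and every
`ε > ⌈k/2⌉ - 1` there is no randomised `O(n^{⌈k/2⌉-ε})`-time algorithm for `k`-SUM (the exponent is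
then `< 1`). [folklore] -/
theorem kSUMConjecture_of_lt {k : ℕ} (hk : 1 ≤ k) (ε : ℝ) (hε : (⌈(k : ℝ) / 2⌉₊ : ℝ) - 1 < ε) :
    ¬ (kSUM k).RandInTimeO fun n => (n : ℝ) ^ ((⌈(k : ℝ) / 2⌉₊ : ℝ) - ε) :=
  kSUM_not_randInTimeO_rpow_of_lt_one hk (by linarith)

/-- For `k ≥ 1`, the `k`-SUM conjecture `KSUMConjecture k` is equivalent to its restriction to the
regime `0 < ε ≤ ⌈k/2⌉ - 1`; for `k = 1, 2` that regime is empty (`kSUMConjecture_one`,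
`kSUMConjecture_two`), for `k ≥ 3` it is the open conjecture (Abboud–Lewi, ICALP 2013, §1,
Conjecture 1). [cite: AbboudLewi2013, §1 Conjecture 1] -/
theorem kSUMConjecture_iff_forall_le {k : ℕ} (hk : 1 ≤ k) :
    KSUMConjecture k ↔ ∀ ε : ℝ, 0 < ε → ε ≤ (⌈(k : ℝ) / 2⌉₊ : ℝ) - 1 →
      ¬ (kSUM k).RandInTimeO fun n => (n : ℝ) ^ ((⌈(k : ℝ) / 2⌉₊ : ℝ) - ε) := by
  refine ⟨fun h ε hε _ => h ε hε, fun h ε hε => ?_⟩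
  rcases le_or_gt ε ((⌈(k : ℝ) / 2⌉₊ : ℝ) - 1) with h1 | h1
  · exact h ε hε h1
  · exact kSUMConjecture_of_lt hk ε h1

/-- **`KSUMConjecture 1` holds**: `1`-SUM ("does the list contain `0`?") has no randomised
`O(n^{1-ε})`-time algorithm for any `ε > 0` (exponent `⌈1/2⌉ = 1`). The case noted as "true by the
standard unread-position adversary argument, not formalised here" in the docstring of
`KSUMConjecture`; an unconditional theorem, not part of the open conjecture. [folklore] -/
theorem kSUMConjecture_one : KSUMConjecture 1 := by
  have h : ((⌈((1 : ℕ) : ℝ) / 2⌉₊ : ℕ) : ℝ) = 1 := by norm_num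
  intro ε hε
  rw [h]
  exact kSUM_not_randInTimeO_rpow_of_lt_one le_rfl (by linarith)

/-- **`KSUMConjecture 2` holds**: `2`-SUM has no randomised `O(n^{1-ε})`-time algorithm for any
`ε > 0` (exponent `⌈2/2⌉ = 1`; print's case `k = 2` of Abboud–Lewi's Conjecture 1 is this trivial
linear lower bound). An unconditional theorem, not part of the open conjecture. [folklore] -/
theorem kSUMConjecture_two : KSUMConjecture 2 := by
  have h : ((⌈((2 : ℕ) : ℝ) / 2⌉₊ : ℕ) : ℝ) = 1 := by norm_num
  intro ε hε
  rw [h]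
  exact kSUM_not_randInTimeO_rpow_of_lt_one (by norm_num) (by linarith)

/-- **The (randomised) 3SUM conjecture holds in the sublinear regime `ε > 1`**: no randomised
`O(n^{2-ε})`-time algorithm for 3SUM when `2 - ε < 1`. [folklore] -/
theorem threeSUMConjecture_of_one_lt (ε : ℝ) (hε : 1 < ε) :
    ¬ threeSUM.RandInTimeO fun n => (n : ℝ) ^ (2 - ε) :=
  threeSUM_not_randInTimeO_rpow_of_lt_one (by linarith)

/-- **The open content of `ThreeSUMConjecture` is exactly the regime `0 < ε ≤ 1`**: the 3SUM
conjecture (VVW IPEC 2015, §2.1, Conjecture 1; Pătraşcu STOC 2010, Conj. 6) in its vendored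
bounded-error form is equivalent to its restriction to `ε ≤ 1`, the cases `ε > 1` being theorems
(`threeSUMConjecture_of_one_lt`); cf. the deterministic `threeSUMConjectureDet_iff_forall_le_one`.
[cite: VassilevskaWilliamsIPEC2015, §2.1 Conjecture 1] -/
theorem threeSUMConjecture_iff_forall_le_one :
    ThreeSUMConjecture ↔
      ∀ ε : ℝ, 0 < ε → ε ≤ 1 → ¬ threeSUM.RandInTimeO fun n => (n : ℝ) ^ (2 - ε) := by
  refine ⟨fun h ε hε _ => h ε hε, fun h ε hε => ?_⟩
  rcases le_or_gt ε 1 with h1 | h1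
  · exact h ε hε h1
  · exact threeSUMConjecture_of_one_lt ε h1

end Literature.Computability.FineGrained
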